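import Summits.Ventures.PercRepro.ThetaOmegaGraphOddCycle

/-!
# The graph form of (Ω): what a free pentagon forces

Addendum 85 supplement 3 (mine-1, gen 46). In the triangle form, let `M` hit the slot triples of
`F` and let `v : Fin 5 → Slot α` be a FREE pentagon: five distinct slots of `F` whose five
consecutive meets lie outside `M`. Two elementary consequences, the first steps of any proof of
Conjecture T⁺ (`OmegaOddCycle`):

* `chord_mem_of_freePentagon` — **the five chords are counted**: `slotMeet U (v i) (v (i + 2)) ∈ M`
  (the triple `v i, v (i + 1), v (i + 2)` has its two cycle meets free);
* `trace_cover_of_freePentagon` — **the traces of an off-pentagon slot form a vertex cover**: for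
  a slot `u` of `F` different from the five, and every `i`, `slotMeet U u (v i) ∈ M` or
  `slotMeet U u (v (i + 1)) ∈ M`; hence (`three_le_card_trace_of_freePentagon`) at least three of
  the five indices `i` have `slotMeet U u (v i) ∈ M` — a vertex cover of the pentagon has at least
  three vertices (`three_le_card_of_cover`, decided on `Fin 5`).
-/

namespace PercRepro.MSTight

open Finset

variable {α : Type*} [DecidableEq α] {U : Finset α} {F : Finset (Finset α)}
  {M : Finset (Finset α × Bool)}

/-- **A free pentagon**: five distinct slots of `F` whose five consecutive meets lie outside `M`. -/
def FreePentagon (U : Finset α) (F : Finset (Finset α)) (M : Finset (Finset α × Bool))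
    (v : Fin 5 → Slot α) : Prop :=
  (∀ i, (v i).1 ∈ F) ∧ Function.Injective v ∧ ∀ i, slotMeet U (v i) (v (i + 1)) ∉ M

/-- **The chords of a free pentagon are counted.** -/
theorem chord_mem_of_freePentagon (hM : HitsTriples U F M) {v : Fin 5 → Slot α}
    (hv : FreePentagon U F M v) (i : Fin 5) : slotMeet U (v i) (v (i + 2)) ∈ M := by
  obtain ⟨hF, hinj, hfree⟩ := hv
  have h01 : v i ≠ v (i + 1) := fun h => by
    have := hinj h
    omega
  have h12 : v (i + 1) ≠ v (i + 2) := fun h => by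
    have := hinj h
    omega
  have h02 : v i ≠ v (i + 2) := fun h => by
    have := hinj h
    omega
  rcases hM (v i) (v (i + 1)) (v (i + 2)) (hF _) (hF _) (hF _) h01 h02 h12 with h | h | h
  · exact absurd h (hfree i)
  · exact h
  · have := hfree (i + 1)
    rw [show i + 1 + 1 = i + 2 from by omega] at this
    exact absurd h this

/-- **The traces of a slot off the pentagon cover every edge of the pentagon.** -/
theorem trace_cover_of_freePentagon (hM : HitsTriples U F M) {v : Fin 5 → Slot α}
    (hv : FreePentagon U F M v) {u : Slot α} (hu : u.1 ∈ F) (hne : ∀ i, u ≠ v i) (i : Fin 5) :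
    slotMeet U u (v i) ∈ M ∨ slotMeet U u (v (i + 1)) ∈ M := by
  obtain ⟨hF, hinj, hfree⟩ := hv
  have h01 : v i ≠ v (i + 1) := fun h => by
    have := hinj h
    omega
  rcases hM u (v i) (v (i + 1)) hu (hF _) (hF _) (hne i) (hne (i + 1)) h01 with h | h | h
  · exact Or.inl h
  · exact Or.inr h
  · exact absurd h (hfree i)

/-- A set of vertices of the pentagon meeting every edge has at least three elements. -/
theorem three_le_card_of_cover (S : Finset (Fin 5)) (hS : ∀ i : Fin 5, i ∈ S ∨ i + 1 ∈ S) :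
    3 ≤ S.card := by
  revert hS
  revert S
  decide

/-- **At least three traces of an off-pentagon slot are counted.** -/
theorem three_le_card_trace_of_freePentagon (hM : HitsTriples U F M) {v : Fin 5 → Slot α}
    (hv : FreePentagon U F M v) {u : Slot α} (hu : u.1 ∈ F) (hne : ∀ i, u ≠ v i) :
    3 ≤ (Finset.univ.filter fun i : Fin 5 => slotMeet U u (v i) ∈ M).card := by
  apply three_le_card_of_cover
  intro i
  rcases trace_cover_of_freePentagon hM hv hu hne i with h | h
  · exact Or.inl (mem_filter.2 ⟨mem_univ _, h⟩)
  · exact Or.inr (mem_filter.2 ⟨mem_univ _, h⟩)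

/-- **Traces of the two slots of one member coincide only in the empty `A`-set**: a meet of the
first slot of `s` is an `A`-set inside `s`, a meet of its second slot is an `A`-set disjoint from
`s` or a marked co-join. -/
theorem slotMeet_topSlot_eq_slotMeet_botSlot {s : Finset α} {v w : Slot α}
    (h : slotMeet U (topSlot s) v = slotMeet U (botSlot s) w) :
    slotMeet U (topSlot s) v = (∅, false) := by
  obtain ⟨t, b⟩ := v
  obtain ⟨t', c⟩ := w
  cases b <;> cases c
  · -- `s ⊓ t = t' \ s`: a subset of `s` disjoint from `s`
    have h' : s ⊓ t = t' \ s := congrArg Prod.fst h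
    show (s ⊓ t, false) = (∅, false)
    congr 1
    apply eq_empty_of_forall_notMem
    intro x hx
    have hxs : x ∈ s := (mem_inter.1 hx).1
    rw [h'] at hx
    exact (mem_sdiff.1 hx).2 hxs
  · exact absurd (congrArg Prod.snd h) Bool.false_ne_true
  · -- `s \ t = t' \ s`
    have h' : s \ t = t' \ s := congrArg Prod.fst h
    show (s \ t, false) = (∅, false)
    congr 1
    apply eq_empty_of_forall_notMem
    intro x hx
    have hxs : x ∈ s := (mem_sdiff.1 hx).1
    rw [h'] at hx
    exact (mem_sdiff.1 hx).2 hxs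
  · exact absurd (congrArg Prod.snd h) Bool.false_ne_true

end PercRepro.MSTight
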